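import Mathlib
import Summits.NavierStokesRegularity.NavierStokesRegularity.Theorems.SubcriticalEnvelopeForwardSourceTailEnvelopeKPFanReduction
import HarnessLib

/-!
# `SubcriticalEnvelope.ForwardSourceTailEnvelopeKP` (stmt-NavierStokesRegularity-27130) — uniform KP FAN
networks: the RATIO-AGNOSTIC TRANSFER chain ⇒ fan (file 2 of 3 of the LEAD-SE rung «uniform KP fan
networks», `--supports`)

`kpFan_shellBound_of_chain`: if at ratio `1+ε₀` every honest viscous solution of the
`|w|²·dyadicTable` lattice (any one-shell datum, non-negative on shells `≥ 1`) obeys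
`(1+ε₀)^{2θk}·½Y_{i,k}(t)² ≤ D·Σ_j ½Y₀_j²` (`D ≥ 1`), then every honest viscous solution of
`kpFanTable w` (`w ≥ 0`) obeys the same bound with the same `θ`, `D`.  Proof: the collapsed amplitudes
`u_k = (w·X_{·,k})/|w|²` (`k ≠ 0`), `u_0 = |X₀|·g/|w|` form an honest chain solution from the datum
`|X₀|/|w|` (sibling file: `kpFan_parallel`, `kpFan_datumShell_normSq`), the chain bound applies, and
`X_{i,k} = w_i u_k` (`k ≥ 1`) with `w_i² ≤ |w|²`, while `X_{i,0}² ≤ X₀(i)²`; for `w = 0` every mode is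
purely damped.

HONEST FRAMING: MODEL lattice statement (rung TL-M2Break); no crux is proved; nothing here concerns
the Navier–Stokes equations; NS regularity is NOT advanced.
-/

noncomputable section

-- the sub-problem namespace `NavierStokesRegularity.NavierStokesRegularity` is the tree's layout (D-0017)
set_option linter.dupNamespace false

namespace Summit.NavierStokesRegularity.NavierStokesRegularity.Theorems

open Set
open Literature.Analysis.FluidPDE.TaoCascade
open Summit.NavierStokesRegularity.NavierStokesRegularity.Theorems.SubOnsagerCeiling
open Summit.NavierStokesRegularity.NavierStokesRegularity.Theses


section Transfer

variable {ε₀ : ℝ} {w : Fin 4 → ℝ}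

/-- **TRANSFER: any ν-uniform weighted shell bound for the scaled chain gives the same bound for the
fan network, at the same scale ratio.**  If at ratio `1+ε₀` every honest viscous solution of the
`|w|²·dyadicTable` lattice (any one-shell datum, non-negative on shells `≥ 1`) obeys
`(1+ε₀)^{2θk}·½Y_{i,k}(t)² ≤ D·Σ_j ½Y₀_j²` (`D ≥ 1`), then every honest viscous solution of
`kpFanTable w` (`w ≥ 0`) obeys the same bound with the same `θ`, `D`: the collapsed amplitudes
`u_k = (w·X_{·,k})/|w|²` (`k ≠ 0`), `u_0 = |X₀|·g/|w|` form an honest chain solution from the datum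
`|X₀|/|w|` (`kpFan_parallel`, `kpFan_datumShell_normSq`), and `X_{i,k} = w_i u_k` for `k ≥ 1`,
`X_{i,0}² ≤ X₀(i)²`.  For `w = 0` every mode is purely damped.  MODEL lattice statement. [this file] -/
theorem kpFan_shellBound_of_chain {θ D : ℝ} (hw : ∀ j, 0 ≤ w j) (hε : 0 < ε₀) (hD1 : 1 ≤ D)
    (hchain : (∑ j, w j ^ 2) ≠ 0 → ∀ ν : ℝ, 0 < ν → ∀ (Y₀ : Fin 4 → ℝ) (s : ℝ), 0 < s →
      ∀ Y : Fin 4 → ℤ → ℝ → ℝ,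
      (∀ (i : Fin 4) (k : ℤ), Y i k 0 = if k = 0 then Y₀ i else 0) →
      (∀ (i : Fin 4) (k : ℤ), k < 0 → ∀ t : ℝ, Y i k t = 0) →
      (∃ M : ℝ, ∀ (t : ℝ) (i : Fin 4) (k : ℤ), (1 + (1 + ε₀) ^ ((10 : ℝ) * k)) * |Y i k t| ≤ M) →
      (∀ (i : Fin 4) (k : ℤ), Continuous (Y i k)) →
      (∀ (i : Fin 4) (k : ℤ), ∀ t ∈ Set.Icc (0 : ℝ) s, HasDerivWithinAt (Y i k)
        (quadTerm ε₀ (fun i₁ i₂ i₃ μ => (∑ j, w j ^ 2) * dyadicTable i₁ i₂ i₃ μ) Y i k t -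
          ν * (1 + ε₀) ^ ((2 : ℝ) * k) * Y i k t) (Set.Icc (0 : ℝ) s) t) →
      (∀ t ∈ Set.Icc (0 : ℝ) s, ∀ (i : Fin 4) (k : ℤ), 1 ≤ k → 0 ≤ Y i k t) →
      ∀ t ∈ Set.Icc (0 : ℝ) s, ∀ (i : Fin 4) (k : ℕ),
        (1 + ε₀) ^ (2 * θ * (k : ℝ)) * ((1 / 2 : ℝ) * Y i (k : ℤ) t ^ 2) ≤
          D * (∑ j : Fin 4, (1 / 2 : ℝ) * Y₀ j ^ 2))
    {ν s : ℝ} (hν : 0 < ν) {X₀ : Fin 4 → ℝ} (hs : 0 < s) {X : Fin 4 → ℤ → ℝ → ℝ}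
    (hinit : ∀ (i : Fin 4) (k : ℤ), X i k 0 = if k = 0 then X₀ i else 0)
    (hlow : ∀ (i : Fin 4) (k : ℤ), k < 0 → ∀ t : ℝ, X i k t = 0)
    (hbd : ∃ M : ℝ, ∀ (t : ℝ) (i : Fin 4) (k : ℤ), (1 + (1 + ε₀) ^ ((10 : ℝ) * k)) * |X i k t| ≤ M)
    (hcont : ∀ (i : Fin 4) (k : ℤ), Continuous (X i k))
    (hder : ∀ (i : Fin 4) (k : ℤ), ∀ t ∈ Set.Icc (0 : ℝ) s, HasDerivWithinAt (X i k)
      (quadTerm ε₀ (kpFanTable w) X i k t - ν * (1 + ε₀) ^ ((2 : ℝ) * k) * X i k t)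
      (Set.Icc (0 : ℝ) s) t)
    (hnn : ∀ t ∈ Set.Icc (0 : ℝ) s, ∀ (i : Fin 4) (k : ℤ), 1 ≤ k → 0 ≤ X i k t) :
    ∀ t ∈ Set.Icc (0 : ℝ) s, ∀ (i : Fin 4) (k : ℕ),
      (1 + ε₀) ^ (2 * θ * (k : ℝ)) * ((1 / 2 : ℝ) * X i (k : ℤ) t ^ 2) ≤
        D * (∑ j : Fin 4, (1 / 2 : ℝ) * X₀ j ^ 2) := by
  intro t ht i k
  have hb0 : (0 : ℝ) < 1 + ε₀ := by linarith
  set E₀ : ℝ := ∑ j : Fin 4, (1 / 2 : ℝ) * X₀ j ^ 2 with hE₀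
  have hE₀i : ∀ j : Fin 4, (1 / 2 : ℝ) * X₀ j ^ 2 ≤ E₀ := fun j =>
    Finset.single_le_sum (f := fun j => (1 / 2 : ℝ) * X₀ j ^ 2) (fun j _ => by positivity)
      (Finset.mem_univ j)
  have hE₀0 : 0 ≤ E₀ := Finset.sum_nonneg fun j _ => by positivity
  have hD0 : 0 ≤ D := le_trans zero_le_one hD1
  -- the datum shell: pure non-growth
  rcases Nat.eq_zero_or_pos k with rfl | hk1
  · have h := kpFan_datumShell_sq_le hw hinit hlow hcont hder hnn hν.le i t ht
    simp only [Nat.cast_zero, mul_zero, Real.rpow_zero, one_mul]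
    calc (1 / 2 : ℝ) * X i 0 t ^ 2 ≤ (1 / 2 : ℝ) * X₀ i ^ 2 := by linarith
      _ ≤ E₀ := hE₀i i
      _ ≤ D * E₀ := le_mul_of_one_le_left hE₀0 hD1
  obtain ⟨W2, hW2⟩ : ∃ W2 : ℝ, W2 = ∑ j, w j ^ 2 := ⟨_, rfl⟩
  simp only [← hW2] at hchain
  by_cases hW : W2 = 0
  · -- `w = 0`: every mode is purely damped
    have hw0 : ∀ j, w j = 0 := fun j => by
      rw [hW2] at hW
      have := (Finset.sum_eq_zero_iff_of_nonneg fun j _ => sq_nonneg (w j)).1 hW j (Finset.mem_univ j)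
      exact pow_eq_zero_iff (n := 2) (by norm_num) |>.1 this
    have hsq := sq_le_sq_init_of_damped (y := X i (k : ℤ))
      (q := fun u => quadTerm ε₀ (kpFanTable w) X i (k : ℤ) u)
      (c := ν * (1 + ε₀) ^ ((2 : ℝ) * ((k : ℕ) : ℤ))) (s := s)
      (mul_nonneg hν.le (Real.rpow_nonneg hb0.le _)) (hcont i k)
      (fun u _ => quadTerm_kpFan_zero ε₀ hw0 X i (k : ℤ) u)
      (fun u hu => hder i k u hu) t ht
    rw [hinit i k, if_neg (by exact_mod_cast hk1.ne')] at hsq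
    have hX0 : X i (k : ℤ) t ^ 2 = 0 := le_antisymm (by simpa using hsq) (sq_nonneg _)
    rw [hX0, mul_zero, mul_zero]
    exact mul_nonneg hD0 hE₀0
  -- `w ≠ 0`: collapse onto the profile `w`
  have hW2pos : 0 < W2 := by
    rw [hW2] at hW ⊢
    exact lt_of_le_of_ne (Finset.sum_nonneg fun j _ => sq_nonneg (w j)) (Ne.symm hW)
  obtain ⟨N2, hN2⟩ : ∃ N2 : ℝ, N2 = ∑ b, X₀ b ^ 2 := ⟨_, rfl⟩
  have hN2nn : 0 ≤ N2 := by rw [hN2]; exact Finset.sum_nonneg fun b _ => sq_nonneg (X₀ b)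
  obtain ⟨g, hg⟩ : ∃ g : ℝ → ℝ, g = fun τ => (∑ b, X₀ b * X b 0 τ) / N2 := ⟨_, rfl⟩
  obtain ⟨u, hu⟩ : ∃ u : ℤ → ℝ → ℝ, u = fun m τ =>
    if m = 0 then Real.sqrt N2 * g τ / Real.sqrt W2 else (∑ j, w j * X j m τ) / W2 := ⟨_, rfl⟩
  obtain ⟨Y, hY⟩ : ∃ Y : Fin 4 → ℤ → ℝ → ℝ, Y = fun j m τ => if j = 0 then u m τ else 0 := ⟨_, rfl⟩
  obtain ⟨Y₀, hY₀⟩ : ∃ Y₀ : Fin 4 → ℝ, Y₀ = fun j => if j = 0 then Real.sqrt N2 / Real.sqrt W2 else 0 :=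
    ⟨_, rfl⟩
  have hsW : 0 < Real.sqrt W2 := Real.sqrt_pos.2 hW2pos
  -- bookkeeping identities
  have hu_ne : ∀ m : ℤ, m ≠ 0 → ∀ τ, u m τ = (∑ j, w j * X j m τ) / W2 := fun m hm τ => by
    simp only [hu, if_neg hm]
  have hu_zero : ∀ τ, u 0 τ = Real.sqrt N2 * g τ / Real.sqrt W2 := fun τ => by simp only [hu, if_true]
  have hg_apply : ∀ τ, g τ = (∑ b, X₀ b * X b 0 τ) / N2 := fun τ => by simp only [hg]
  have hu_neg : ∀ m : ℤ, m < 0 → ∀ τ, u m τ = 0 := fun m hm τ => by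
    rw [hu_ne m hm.ne τ]
    simp [hlow _ m hm τ]
  have hmoment : ∀ m : ℤ, m ≠ 0 → ∀ τ, (∑ j, w j * X j m τ) = W2 * u m τ := fun m hm τ => by
    rw [hu_ne m hm τ]; field_simp
  -- coherence of the datum shell and parallelism of the higher shells
  have hu0sq : ∀ τ, W2 * u 0 τ ^ 2 = N2 * g τ ^ 2 := by
    intro τ
    rw [hu_zero, div_pow, mul_pow, Real.sq_sqrt hN2nn, Real.sq_sqrt hW2pos.le]
    field_simp
  have hcoh : ∀ τ ∈ Icc (0 : ℝ) s, ∑ a, X a 0 τ ^ 2 = W2 * u 0 τ ^ 2 := by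
    intro τ hτ
    have hc := kpFan_datumShell_normSq hw hinit hlow hcont hder hnn hν.le τ hτ
    have hsq : ∀ a, X a 0 τ ^ 2 = X₀ a ^ 2 * g τ ^ 2 := fun a => by
      rw [hc a, hg_apply, ← hN2]; ring
    rw [Finset.sum_congr rfl fun a _ => hsq a, ← Finset.sum_mul, hu0sq, ← hN2]
  have hpar : ∀ m : ℤ, 1 ≤ m → ∀ τ ∈ Icc (0 : ℝ) s, ∀ a, X a m τ = w a * u m τ := by
    intro m hm τ hτ a
    rw [hu_ne m (by omega) τ, hW2]
    have hW' : (∑ j, w j ^ 2) ≠ 0 := by rw [← hW2]; exact hW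
    exact kpFan_parallel hw hW' hinit hcont hder hnn hb0 hν.le hm a τ hτ
  have hparsq : ∀ m : ℤ, 1 ≤ m → ∀ τ ∈ Icc (0 : ℝ) s, ∑ a, X a m τ ^ 2 = W2 * u m τ ^ 2 := by
    intro m hm τ hτ
    rw [Finset.sum_congr rfl fun a _ => by rw [hpar m hm τ hτ a, mul_pow], ← Finset.sum_mul, ← hW2]
  -- the collapsed family is an honest chain solution
  have h1 : ∀ (j : Fin 4) (m : ℤ), Y j m 0 = if m = 0 then Y₀ j else 0 := by
    intro j m
    by_cases hj : j = 0
    · subst hj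
      simp only [hY, hY₀, if_true]
      by_cases hm : m = 0
      · subst hm
        rw [if_pos rfl, hu_zero]
        by_cases hN : N2 = 0
        · simp [hN]
        · have hg0 : g 0 = 1 := by
            rw [hg_apply]
            rw [Finset.sum_congr rfl fun b _ => by rw [hinit b 0, if_pos rfl]]
            rw [show (∑ b, X₀ b * X₀ b) = N2 from hN2 ▸ Finset.sum_congr rfl fun b _ => by ring]
            exact div_self hN
          rw [hg0, mul_one]
      · rw [if_neg hm, hu_ne m hm]
        simp [hinit, hm]
    · simp only [hY, hY₀, if_neg hj]
      split_ifs <;> rfl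
  have h2 : ∀ (j : Fin 4) (m : ℤ), m < 0 → ∀ τ : ℝ, Y j m τ = 0 := by
    intro j m hm τ
    by_cases hj : j = 0
    · subst hj; simp only [hY, if_true]; exact hu_neg m hm τ
    · simp only [hY, if_neg hj]
  obtain ⟨M, hM⟩ := hbd
  have hM0 : 0 ≤ M := by
    have h := hM 0 0 0
    have : (0 : ℝ) ≤ (1 + (1 + ε₀) ^ ((10 : ℝ) * ((0 : ℤ) : ℝ))) * |X 0 0 0| := by positivity
    exact this.trans h
  have h3 : ∃ M' : ℝ, ∀ (τ : ℝ) (j : Fin 4) (m : ℤ),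
      (1 + (1 + ε₀) ^ ((10 : ℝ) * m)) * |Y j m τ| ≤ M' := by
    refine ⟨(∑ j, w j) * M / W2 + 2 * (Real.sqrt N2 * (∑ b, |X₀ b| * M) / N2 / Real.sqrt W2), ?_⟩
    have hA : 0 ≤ (∑ j, w j) * M / W2 :=
      div_nonneg (mul_nonneg (Finset.sum_nonneg fun j _ => hw j) hM0) hW2pos.le
    have hB : 0 ≤ 2 * (Real.sqrt N2 * (∑ b, |X₀ b| * M) / N2 / Real.sqrt W2) := by
      have : 0 ≤ ∑ b, |X₀ b| * M := Finset.sum_nonneg fun b _ => mul_nonneg (abs_nonneg _) hM0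
      positivity
    intro τ j m
    by_cases hj : j = 0
    swap
    · simp only [hY, if_neg hj, abs_zero, mul_zero]; exact add_nonneg hA hB
    subst hj
    simp only [hY, if_true]
    by_cases hm : m = 0
    · subst hm
      rw [hu_zero]
      have hXb : ∀ b, |X b 0 τ| ≤ M := fun b => by
        have h := hM τ b 0
        have hw1 : (1 : ℝ) ≤ 1 + (1 + ε₀) ^ ((10 : ℝ) * ((0 : ℤ) : ℝ)) := by
          have : (0 : ℝ) ≤ (1 + ε₀) ^ ((10 : ℝ) * ((0 : ℤ) : ℝ)) := Real.rpow_nonneg hb0.le _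
          linarith
        calc |X b 0 τ| = 1 * |X b 0 τ| := (one_mul _).symm
          _ ≤ (1 + (1 + ε₀) ^ ((10 : ℝ) * ((0 : ℤ) : ℝ))) * |X b 0 τ| :=
              mul_le_mul_of_nonneg_right hw1 (abs_nonneg _)
          _ ≤ M := h
      have hgb : |g τ| ≤ (∑ b, |X₀ b| * M) / N2 := by
        rw [hg_apply, abs_div, abs_of_nonneg hN2nn]
        by_cases hN : N2 = 0
        · simp [hN]
        · refine div_le_div_of_nonneg_right ?_ hN2nn
          refine (Finset.abs_sum_le_sum_abs _ _).trans (Finset.sum_le_sum fun b _ => ?_)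
          rw [abs_mul]
          exact mul_le_mul_of_nonneg_left (hXb b) (abs_nonneg _)
      have hwt : (1 + (1 + ε₀) ^ ((10 : ℝ) * ((0 : ℤ) : ℝ))) = 2 := by norm_num
      rw [hwt, abs_div, abs_of_pos hsW, abs_mul, abs_of_nonneg (Real.sqrt_nonneg _)]
      have : Real.sqrt N2 * |g τ| / Real.sqrt W2 ≤
          Real.sqrt N2 * (∑ b, |X₀ b| * M) / N2 / Real.sqrt W2 := by
        rw [mul_div_assoc, mul_div_assoc, mul_div_assoc]
        refine mul_le_mul_of_nonneg_left ?_ (Real.sqrt_nonneg _)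
        exact div_le_div_of_nonneg_right hgb hsW.le
      linarith
    · rw [hu_ne m hm]
      have hterm : ∀ j, (1 + (1 + ε₀) ^ ((10 : ℝ) * m)) * (w j * |X j m τ|) ≤ w j * M := by
        intro j
        have := hM τ j m
        calc (1 + (1 + ε₀) ^ ((10 : ℝ) * m)) * (w j * |X j m τ|)
            = w j * ((1 + (1 + ε₀) ^ ((10 : ℝ) * m)) * |X j m τ|) := by ring
          _ ≤ w j * M := mul_le_mul_of_nonneg_left this (hw j)
      rw [abs_div, abs_of_pos hW2pos]
      have hsum : |∑ j, w j * X j m τ| ≤ ∑ j, w j * |X j m τ| :=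
        (Finset.abs_sum_le_sum_abs _ _).trans (Finset.sum_le_sum fun j _ => by
          rw [abs_mul, abs_of_nonneg (hw j)])
      have hwpos : 0 ≤ 1 + (1 + ε₀) ^ ((10 : ℝ) * m) := by
        have : (0 : ℝ) ≤ (1 + ε₀) ^ ((10 : ℝ) * m) := Real.rpow_nonneg hb0.le _
        linarith
      calc (1 + (1 + ε₀) ^ ((10 : ℝ) * m)) * (|∑ j, w j * X j m τ| / W2)
          = ((1 + (1 + ε₀) ^ ((10 : ℝ) * m)) * |∑ j, w j * X j m τ|) / W2 := by ring
        _ ≤ ((1 + (1 + ε₀) ^ ((10 : ℝ) * m)) * ∑ j, w j * |X j m τ|) / W2 :=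
            div_le_div_of_nonneg_right (mul_le_mul_of_nonneg_left hsum hwpos) hW2pos.le
        _ = (∑ j, (1 + (1 + ε₀) ^ ((10 : ℝ) * m)) * (w j * |X j m τ|)) / W2 := by
            rw [Finset.mul_sum]
        _ ≤ (∑ j, w j * M) / W2 :=
            div_le_div_of_nonneg_right (Finset.sum_le_sum fun j _ => hterm j) hW2pos.le
        _ = (∑ j, w j) * M / W2 := by rw [Finset.sum_mul]
        _ ≤ (∑ j, w j) * M / W2 + 2 * (Real.sqrt N2 * (∑ b, |X₀ b| * M) / N2 / Real.sqrt W2) :=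
            le_add_of_nonneg_right hB
  have h4 : ∀ (j : Fin 4) (m : ℤ), Continuous (Y j m) := by
    intro j m
    by_cases hj : j = 0
    · subst hj
      have : Y 0 m = u m := funext fun τ => by simp only [hY, if_true]
      rw [this]
      by_cases hm : m = 0
      · subst hm
        have : u 0 = fun τ => Real.sqrt N2 * g τ / Real.sqrt W2 := funext fun τ => hu_zero τ
        rw [this]
        have hgc : Continuous g := by
          rw [hg]
          exact (continuous_finsetSum _ fun b _ => continuous_const.mul (hcont b 0)).div_const _
        exact (continuous_const.mul hgc).div_const _
      · have : u m = fun τ => (∑ j, w j * X j m τ) / W2 := funext fun τ => hu_ne m hm τ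
        rw [this]
        exact (continuous_finsetSum _ fun j _ => continuous_const.mul (hcont j m)).div_const _
    · have : Y j m = fun _ => 0 := funext fun τ => by simp only [hY, if_neg hj]
      rw [this]; exact continuous_const
  -- the chain equation of motion for `u`
  have hΛ0 : (1 + ε₀) ^ ((5 : ℝ) * (((0 : ℤ) : ℝ)) / 2) = 1 := by simp
  have h5u : ∀ m : ℤ, ∀ τ ∈ Icc (0 : ℝ) s, HasDerivWithinAt (u m)
      (W2 * ((1 + ε₀) ^ ((5 : ℝ) * (m - 1) / 2) * u (m - 1) τ ^ 2 -
          (1 + ε₀) ^ ((5 : ℝ) * m / 2) * (u m τ * u (m + 1) τ)) -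
        ν * (1 + ε₀) ^ ((2 : ℝ) * m) * u m τ) (Icc (0 : ℝ) s) τ := by
    intro m τ hτ
    by_cases hm : m = 0
    · -- the datum shell: `u₀ = |X₀| g / |w|`, `g' = -λ₀ g`
      subst hm
      have hfun : u 0 = fun τ => (Real.sqrt N2 / (N2 * Real.sqrt W2)) * ∑ b, X₀ b * X b 0 τ := by
        funext τ; rw [hu_zero, hg_apply]; ring
      have hS := HasDerivWithinAt.fun_sum (u := Finset.univ) (A := fun b τ => X₀ b * X b 0 τ)
        fun b _ => (kpFan_datumShell_deriv hlow hder b τ hτ).const_mul (X₀ b)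
      have hm1 : ∀ m : ℤ, m < 0 → u m τ = 0 := fun m hm => hu_neg m hm τ
      have hM1 : (∑ j, w j * X j 1 τ) = W2 * u 1 τ := hmoment 1 one_ne_zero τ
      have hsum : (∑ b, X₀ b * (-((∑ j, w j * X j 1 τ) + ν) * X b 0 τ)) =
          -((∑ j, w j * X j 1 τ) + ν) * ∑ b, X₀ b * X b 0 τ := by
        rw [Finset.mul_sum]; exact Finset.sum_congr rfl fun b _ => by ring
      rw [hfun]
      refine (hS.const_mul (Real.sqrt N2 / (N2 * Real.sqrt W2))).congr_deriv ?_
      beta_reduce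
      push_cast
      simp only [zero_sub, mul_zero, zero_div, Real.rpow_zero, mul_one]
      rw [hm1 (-1) (by norm_num), hsum, hM1]
      field_simp
      ring
    · -- shells `m ≠ 0`: `u_m = (w·X_m)/|w|²`
      have hfun : u m = fun τ => (∑ j, w j * X j m τ) / W2 := funext fun τ => hu_ne m hm τ
      have hdm : HasDerivWithinAt (u m)
          (((∑ j, w j ^ 2) * ((1 + ε₀) ^ ((5 : ℝ) * (m - 1) / 2) * ∑ a, X a (m - 1) τ ^ 2) -
            ((1 + ε₀) ^ ((5 : ℝ) * m / 2) * (∑ j, w j * X j (m + 1) τ) + ν * (1 + ε₀) ^ ((2 : ℝ) * m)) *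
              (∑ j, w j * X j m τ)) / W2) (Icc (0 : ℝ) s) τ := by
        rw [hfun]; exact (kpFan_moment_deriv hder m τ hτ).div_const W2
      refine hdm.congr_deriv ?_
      -- `Σ_a X_{a,m-1}² = W2 u_{m-1}²` and `Σ_j w_j X_{j,m} = W2 u_m`, `Σ_j w_j X_{j,m+1} = W2 u_{m+1}`
      have hSA : (∑ a, X a (m - 1) τ ^ 2) = W2 * u (m - 1) τ ^ 2 := by
        rcases lt_trichotomy m 1 with hlt | heq | hgt
        · have hneg : m - 1 < 0 := by omega
          rw [hu_neg (m - 1) hneg τ]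
          simp [hlow _ (m - 1) hneg τ]
        · subst heq; simpa using hcoh τ hτ
        · exact hparsq (m - 1) (by omega) τ hτ
      rw [← hW2, hSA, hmoment m hm τ]
      by_cases hm1 : m + 1 = 0
      · have hmneg : m < 0 := by omega
        rw [hu_neg m hmneg τ]
        field_simp
        ring
      · rw [hmoment (m + 1) hm1 τ]
        field_simp
        ring
  have h5 : ∀ (j : Fin 4) (m : ℤ), ∀ τ ∈ Icc (0 : ℝ) s, HasDerivWithinAt (Y j m)
      (quadTerm ε₀ (fun i₁ i₂ i₃ μ => W2 * dyadicTable i₁ i₂ i₃ μ) Y j m τ -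
        ν * (1 + ε₀) ^ ((2 : ℝ) * m) * Y j m τ) (Icc (0 : ℝ) s) τ := by
    intro j m τ hτ
    by_cases hj : j = 0
    · subst hj
      have hfun : Y 0 m = u m := funext fun τ => by simp only [hY, if_true]
      rw [hfun, dyadicRatioTwo_quadTerm_const_mul (β := dyadicTable) (c := W2) (fun _ _ _ _ => rfl),
        quadTerm_dyadicTable_zero]
      simp only [hY, if_true]
      exact h5u m τ hτ
    · have hfun : Y j m = fun _ => 0 := funext fun τ => by simp only [hY, if_neg hj]
      have hq : quadTerm ε₀ (fun i₁ i₂ i₃ μ => W2 * dyadicTable i₁ i₂ i₃ μ) Y j m τ = 0 :=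
        dyadicRatioTwo_quadTerm_of_ne (fun _ _ _ _ => rfl) _ hj m τ
      rw [hfun, hq]
      simpa using hasDerivWithinAt_const τ (Icc (0 : ℝ) s) (0 : ℝ)
  have h6 : ∀ τ ∈ Icc (0 : ℝ) s, ∀ (j : Fin 4) (m : ℤ), 1 ≤ m → 0 ≤ Y j m τ := by
    intro τ hτ j m hm
    by_cases hj : j = 0
    · subst hj
      simp only [hY, if_true]
      rw [hu_ne m (by omega)]
      exact div_nonneg (Finset.sum_nonneg fun j _ => mul_nonneg (hw j) (hnn τ hτ j m hm)) hW2pos.le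
    · simp only [hY, if_neg hj]; exact le_rfl
  -- apply the chain barrier to the collapsed family
  have hB := hchain hW ν hν Y₀ s hs Y h1 h2 h3 h4 h5 h6 t ht 0 k
  have hY0k : Y 0 (k : ℤ) t = u (k : ℤ) t := by simp only [hY, if_true]
  have hdat : (∑ j : Fin 4, (1 / 2 : ℝ) * Y₀ j ^ 2) = (1 / 2 : ℝ) * (N2 / W2) := by
    simp only [hY₀]
    rw [Fin.sum_univ_four]
    simp only [if_true, Fin.one_eq_zero_iff, Fin.reduceEq, if_false]
    rw [div_pow, Real.sq_sqrt hN2nn, Real.sq_sqrt hW2pos.le]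
    norm_num
  rw [hY0k, hdat] at hB
  -- unscale: `X_{i,k} = w_i u_k`, `w_i² ≤ W2`, `½ N2 = E₀`
  have hXi : X i (k : ℤ) t = w i * u (k : ℤ) t := hpar (k : ℤ) (by exact_mod_cast hk1) t ht i
  have hwi : w i ^ 2 ≤ W2 := by
    rw [hW2]
    exact Finset.single_le_sum (f := fun j => w j ^ 2) (fun j _ => sq_nonneg (w j)) (Finset.mem_univ i)
  have hN2E : (1 / 2 : ℝ) * N2 = E₀ := by rw [hE₀, hN2, Finset.mul_sum]
  have hwt0 : 0 ≤ (1 + ε₀) ^ (2 * θ * (k : ℝ)) * ((1 / 2 : ℝ) * u (k : ℤ) t ^ 2) :=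
    mul_nonneg (Real.rpow_nonneg hb0.le _) (by positivity)
  calc (1 + ε₀) ^ (2 * θ * (k : ℝ)) * ((1 / 2 : ℝ) * X i (k : ℤ) t ^ 2)
      = w i ^ 2 * ((1 + ε₀) ^ (2 * θ * (k : ℝ)) * ((1 / 2 : ℝ) * u (k : ℤ) t ^ 2)) := by
        rw [hXi]; ring
    _ ≤ W2 * (D * ((1 / 2 : ℝ) * (N2 / W2))) :=
        mul_le_mul hwi hB hwt0 hW2pos.le
    _ = D * ((1 / 2 : ℝ) * N2) := by field_simp
    _ = D * E₀ := by rw [hN2E]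

end Transfer

end Summit.NavierStokesRegularity.NavierStokesRegularity.Theorems

end
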